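import Summits.ABC.IUTFork.Conditional.Layer5OfSV10
import Literature.IUT.HodgeTheaters.GlobalFrobenioidsCoricRigidityFieldLevelOfFG
import HarnessLib

/-!
# Layer-5 certificate, ADDITIVE PART v0.11 — [IUTchI] Ex 5.1 (v): the Kummer-injectivity law (iv) `h_Ex51v_div` (E51/L26) DISCHARGED from
# FINITE GENERATION of the fixed fields, in all four field-level E51 conjuncts (conj 1 ∞κ, conj 2 ∞κ×, E51/L27 and its «respectively ∞κ×» twin)
# (director-abc (C2); plan/L5/LAYER5-CERT-SPEC.md §7; abc-iut-L5-lead gen 6 RULINGS #73 (3) «CERT v0.11 E51 (iv) := hfg», #76 (1); writer abc-iut-L5-d1 gen 6)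

cert L5 v0.11 additive part (one module, PROOF-ONLY: no `def`, no `instance`, no `axiom`, no `sorry`, no `notation`; every input BY NAME; nothing of
v0–v0.10 is touched).  FOUR theorems, then the top `layer5_of_S_v11`:

* (iv-1) `layer5_held_ex51v_v11_infκ_fg` — conjunct 1 (E51/L29, ∞κ; v0.5 field-level form) with the LAW `h_Ex51v_div` («an `H`-fixed `a ≠ 0` admitting
  `H`-fixed `n`-th roots for all `n` is `1`», E51/L26) REPLACED by the STRUCTURAL side-condition `h_Ex51v_fg` («for every open normal `H ≤ π₁^rat` the
  `H`-fixed rational functions lie in the subfield generated by a FINITE set» — at the genuine datum `K_rat^H` is a finite extension of the function field of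
  `C_{F_mod}`, Ex 5.1 (i) p.123), via `NFBridgeRecon.existsUniqueCoricStructure_infκPair_fieldLevel_of_fg` (`GlobalFrobenioidsCoricRigidityFieldLevelOfFG`,
  over abc-iut-w4-d056 p436822) whose engine is the CLASSICAL theorem of layer L4 `eq_one_of_fixed_of_forall_exists_fixed_pow_eq` ([AbsTopIII] Rmk 1.5.4
  (i)(ii): finitely generated fields over number fields are Kummer-faithful, `AbsTopIII/KummerFaithfulDivisibleOverNumberField`); `char K_rat = 0` is forced by
  `hprim` (`charZero_krat_of_hprim`), and `h_Ex51v_fg` is stated over the PRIME subfield (`Subfield.closure`), so no `ℚ`-algebra / instance atom enters.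
* (iv-2) `layer5_held_ex51v_v11_infκx_fg` — conjunct 2 (∞κ×; v0.7 form) likewise (`…_infκxPair_fieldLevel_of_fg`).
* (iv-3) `layer5_held_ex51v_v11_L27_genuine_fg` — E51/L27 at the genuine ∞κ Kummer container (v0.7 headline form, abc-iut-f-190 p443183) with
  `hdiv := NFBridgeRecon.hdiv_of_fixed_subset_adjoin_finset …`.
* (iv-4) `layer5_held_ex51v_v11_L27x_genuine_fg` — the «respectively ∞κ×» display (v0.8 coverage item, abc-iut-f-190 p443477) likewise.
NV of the structural hypothesis together with the whole field-level binder set: abc-iut-w4-d050's p449088 `GlobalFrobenioidsCoricFieldLevelNonVacuityFG`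
(NV-L5 #50, Galois toy) and the ARITHMETIC function-field-side model of RULINGS #76 (1) (`…ArithmeticModel`, ∞κ× degenerate) — inhabited ≠ discharged.

CENSUS v0.11 (BINDER CONVENTION of RULINGS #40 (1); HEADLINE RULE of RULINGS #61/#69): the shared E51 field-level LAW list `div ordmul polex zero` (4) becomes
`ordmul polex zero` (3) + the structural side-condition `fg`; hence headline most-reduced **CONE 36 → 35 (+2 record-laws in `P`, +1 in `M'`) · FACT 0 · side 15 → 16 ·
NV 3**.  Nodes 139 unchanged.  S-FREE.  Post-freeze-additive module imported for the closers (not a cone member): GlobalFrobenioidsCoricRigidityFieldLevelOfFG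
(proof-only; over L4's AbsTopIII/KummerFaithfulDivisibleOverNumberField, proof-only).

Mochizuki, *Inter-universal Teichmüller theory I: construction of Hodge theaters*, kurims manuscript (May 2020) [cite: Mochizuki2012]
(D-0012 claim key; series status DISPUTED; pages = kurims preprint render IUTchI-kurims-url-690e7b3c6199).  HONEST FRAMING: nothing in this file asserts
that abc is proved or refuted or takes a side on [IUTchIII] Cor. 3.12 (nor on [IUTchI]); every binder is an ASSUMPTION LABEL; `h_Ex51v_fg` is a STRUCTURAL
hypothesis about the interface `NFBridgeRecon` (true at the genuine function-field datum, not asserted for the abstract record); in (iv-3)/(iv-4) the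
étale-like side is SPECIALISED to the Frobenioid side along the [AbsTopIII] Thm 1.9 (d) identification (FACT-policy); typed ≠ inhabited ≠ discharged;
indexed ≠ endorsed; establishment = OUR kernel check only.
-/

namespace Summit.ABC.IUTFork.Conditional

open CategoryTheory Literature.IUT.HodgeTheaters ProfiniteGrp ProfiniteGrp.ProfiniteCompletion
open Literature.AnabelianGeometry.EtaleTheta Literature.AnabelianGeometry.EtaleTheta.ZHatLevel
open scoped Pointwise
universe u v

/-! ## Ex 5.1 (v), conjunct 1 (E51/L29, ∞κ): the Kummer-injectivity law (iv) DISCHARGED from finite generation of the fixed fields -/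

/-- **Row 1116, node `IUTchI:Ex5.1(v)`, conjunct 1 (E51/L29, ∞κ) at field level with the Kummer-injectivity LAW (iv) `h_Ex51v_div` (E51/L26)
DISCHARGED from FINITE GENERATION of the fixed fields** (closer `NFBridgeRecon.existsUniqueCoricStructure_infκPair_fieldLevel_of_fg`,
`GlobalFrobenioidsCoricRigidityFieldLevelOfFG.lean`, over abc-iut-w4-d056 p436822 and the L4 classical theorem [AbsTopIII] Rmk 1.5.4 (i)(ii)
`eq_one_of_fixed_of_forall_exists_fixed_pow_eq` — «finitely generated fields over number fields are Kummer-faithful: an element with `n`-th roots for all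
`n` is `1`», `AbsTopIII/KummerFaithfulDivisibleOverNumberField`; NV with the structural hypothesis at the Galois toy / at an arithmetic function-field model:
abc-iut-w4-d050 p449088 `…NonVacuityFG` = NV-L5 #50, `…ArithmeticModel` RULINGS #76 (1)).  Versus v0.5's `layer5_held_ex51v_v5_fieldLevel`: the LAW
`h_Ex51v_div` («an `H`-fixed `a ≠ 0` with `H`-fixed `n`-th roots for all `n` is `1`») is REPLACED by the STRUCTURAL side-condition `h_Ex51v_fg` («the
`H`-fixed rational functions lie in the subfield generated by a FINITE set», at the genuine datum: `K_rat^H` is a finite extension of the function field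
of `C_{F_mod}`, Ex 5.1 (i) p.123), stated over the prime subfield (no `ℚ`-algebra atom; `char K_rat = 0` follows from `hprim`,
`charZero_krat_of_hprim`).  LAW binders `h_Ex51v_ordmul` · `h_Ex51v_polex` · `h_Ex51v_zero` = 3 (v0.5: 4); side `hroot hprim h1 hpow` + `h_Ex51v_fg` = 5;
instance atoms 0.  Nothing here asserts that abc is proved or refuted or takes a side on [IUTchIII] Cor. 3.12; a binder is an assumption label; typed ≠
discharged. -/
theorem layer5_held_ex51v_v11_infκ_fg (N : NFBridgeRecon.{0})
    -- DATUM side-conditions of the genuine `K_rat = L̄_C` (algebraically closed): all roots, all roots of unity; `𝕄^⊛_∞κ` divisible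
    (hroot : ∀ a : N.Krat, a ≠ 0 → ∀ n : ℕ, 0 < n → ∃ b : N.Krat, b ^ n = a)
    (hprim : ∀ n : ℕ, 0 < n → ∃ ζ : N.Krat, IsPrimitiveRoot ζ n)
    (h1 : (1 : N.Krat) ∈ N.Minfκ) (hpow : ∀ (f : N.Krat) (n : ℕ), 0 < n → (f ∈ N.Minfκ ↔ f ^ n ∈ N.Minfκ))
    -- STRUCTURAL (replaces LAW E51/L26): the fixed field of every open normal `H ≤ π₁^rat` is finitely generated (over the prime field)
    (h_Ex51v_fg : ∀ H : OpenNormalSubgroup N.piRat, ∃ s : Finset N.Krat,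
      ∀ a : N.Krat, (∀ h : N.piRat, h ∈ H → h • a = a) → a ∈ Subfield.closure (s : Set N.Krat))
    -- DATA: orders at points; LAW (o): each `ord_x` is additive on the fixed nonzero rational functions ([AbsTopIII] Prop. 1.6 (iii) via Kummer)
    {X : Type v} (ord : X → N.Krat → ℤ)
    (h_Ex51v_ordmul : ∀ (x : X) (a b : N.Krat), a ≠ 0 → b ≠ 0 → (∀ g : N.piRat, g • a = a) → (∀ g : N.piRat, g • b = b) →
      ord x (a * b) = ord x a + ord x b)
    -- LAW Rmk 3.1.7 (i)/(ii) (as v0.2/v0.3)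
    (h_Ex51v_polex : ∀ f' ∈ N.Minfκx, (∀ g : N.piRat, g • f' = f') →
      ∀ x₁ x₂ : X, x₁ ≠ x₂ → ¬ (ord x₁ f' < 0 ∧ ord x₂ f' < 0))
    (h_Ex51v_zero : ∃ f ∈ N.Minfκ, (∀ g : N.piRat, g • f = f) ∧
      ∃ x₁ x₂ : X, x₁ ≠ x₂ ∧ 0 < ord x₁ f ∧ 0 < ord x₂ f) :
    ExistsUniqueCoricStructure N.piRat N.infκPair := by  -- E51/L29 (∞κ), field level, (iv) discharged from finite generation
  haveI : CharZero N.Krat := N.charZero_krat_of_hprim hprim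
  have hfg' : ∀ H : OpenNormalSubgroup N.piRat, ∃ s : Finset N.Krat, ∀ a : N.Krat,
      (∀ h : N.piRat, h ∈ H → h • a = a) → a ∈ IntermediateField.adjoin ℚ (s : Set N.Krat) := fun H => by
    obtain ⟨s, hs⟩ := h_Ex51v_fg H
    refine ⟨s, fun a ha => ?_⟩
    rw [← IntermediateField.mem_toSubfield, IntermediateField.adjoin_toSubfield]
    exact Subfield.closure_mono Set.subset_union_right (hs a ha)
  exact N.existsUniqueCoricStructure_infκPair_fieldLevel_of_fg hroot hprim h1 hpow hfg' ord h_Ex51v_ordmul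
    (fun f' hf' hfix => h_Ex51v_polex f' (N.minfκ_subset hf') hfix) h_Ex51v_zero

/-! ## Ex 5.1 (v), conjunct 2 (E51/L29, ∞κ×): (iv) discharged from finite generation -/

/-- **Row 1116, node `IUTchI:Ex5.1(v)`, conjunct 2 (E51/L29, ∞κ×) at field level with (iv) DISCHARGED from finite generation** (closer
`NFBridgeRecon.existsUniqueCoricStructure_infκxPair_fieldLevel_of_fg`; as `layer5_held_ex51v_v11_infκ_fg`).  Versus v0.7's
`layer5_held_ex51v_v7_infκx_fieldLevel`: `h_Ex51v_div` ↦ the structural `h_Ex51v_fg` (shared with conjunct 1).  LAW `ordmul polex zero` = 3; side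
`hroot hprim h1x hpowx` + `h_Ex51v_fg`.  Nothing here asserts that abc is proved or refuted or takes a side on [IUTchIII] Cor. 3.12; a binder is an
assumption label; typed ≠ discharged. -/
theorem layer5_held_ex51v_v11_infκx_fg (N : NFBridgeRecon.{0})
    -- DATUM side-conditions of the genuine `K_rat = L̄_C` (algebraically closed): all roots, all roots of unity; `𝕄^⊛_∞κ×` divisible with `1`
    (hroot : ∀ a : N.Krat, a ≠ 0 → ∀ n : ℕ, 0 < n → ∃ b : N.Krat, b ^ n = a)
    (hprim : ∀ n : ℕ, 0 < n → ∃ ζ : N.Krat, IsPrimitiveRoot ζ n)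
    (h1x : (1 : N.Krat) ∈ N.Minfκx) (hpowx : ∀ (f : N.Krat) (n : ℕ), 0 < n → (f ∈ N.Minfκx ↔ f ^ n ∈ N.Minfκx))
    -- STRUCTURAL (replaces LAW E51/L26): fixed fields of open normal subgroups finitely generated over the prime field
    (h_Ex51v_fg : ∀ H : OpenNormalSubgroup N.piRat, ∃ s : Finset N.Krat,
      ∀ a : N.Krat, (∀ h : N.piRat, h ∈ H → h • a = a) → a ∈ Subfield.closure (s : Set N.Krat))
    -- DATA: orders at points; LAW (o): additivity on the fixed nonzero rational functions (as v0.5 conjunct 1)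
    {X : Type v} (ord : X → N.Krat → ℤ)
    (h_Ex51v_ordmul : ∀ (x : X) (a b : N.Krat), a ≠ 0 → b ≠ 0 → (∀ g : N.piRat, g • a = a) → (∀ g : N.piRat, g • b = b) →
      ord x (a * b) = ord x a + ord x b)
    -- LAW Rmk 3.1.7 (i)/(ii) (as v0.2/v0.3/v0.5)
    (h_Ex51v_polex : ∀ f' ∈ N.Minfκx, (∀ g : N.piRat, g • f' = f') →
      ∀ x₁ x₂ : X, x₁ ≠ x₂ → ¬ (ord x₁ f' < 0 ∧ ord x₂ f' < 0))
    (h_Ex51v_zero : ∃ f ∈ N.Minfκ, (∀ g : N.piRat, g • f = f) ∧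
      ∃ x₁ x₂ : X, x₁ ≠ x₂ ∧ 0 < ord x₁ f ∧ 0 < ord x₂ f) :
    ExistsUniqueCoricStructure N.piRat N.infκxPair := by  -- E51/L29 (∞κ×), field level, (iv) discharged from finite generation
  haveI : CharZero N.Krat := N.charZero_krat_of_hprim hprim
  have hfg' : ∀ H : OpenNormalSubgroup N.piRat, ∃ s : Finset N.Krat, ∀ a : N.Krat,
      (∀ h : N.piRat, h ∈ H → h • a = a) → a ∈ IntermediateField.adjoin ℚ (s : Set N.Krat) := fun H => by
    obtain ⟨s, hs⟩ := h_Ex51v_fg H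
    refine ⟨s, fun a ha => ?_⟩
    rw [← IntermediateField.mem_toSubfield, IntermediateField.adjoin_toSubfield]
    exact Subfield.closure_mono Set.subset_union_right (hs a ha)
  exact N.existsUniqueCoricStructure_infκxPair_fieldLevel_of_fg hroot hprim h1x hpowx hfg' ord h_Ex51v_ordmul h_Ex51v_polex
    (h_Ex51v_zero.imp fun _ hf => ⟨N.minfκ_subset hf.1, hf.2⟩)

/-! ## E51/L27 at the genuine ∞κ container: (iv) discharged from finite generation -/

open scoped Classical in
/-- **Row 1116, node `IUTchI:Ex5.1(v)`, conjunct E51/L27 at the genuine ∞κ Kummer container (symmetric form, v0.7 headline «L27 0») with (iv)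
DISCHARGED from finite generation** (abc-iut-f-190's `NFBridgeRecon.uniqueCyclotomeIso_infκ_fieldLevel` p443183 fed with
`hdiv := N.hdiv_of_fixed_subset_adjoin_finset …`).  Versus v0.7's `layer5_held_ex51v_v7_L27_genuine`: `h_Ex51v_div` ↦ the structural `h_Ex51v_fg`.
LAW (re-bound from conjunct 1) `ordmul polex zero`; side `hroot hprim` + `h_Ex51v_fg`; 0 new.  Nothing here asserts that abc is proved or refuted or
takes a side on [IUTchIII] Cor. 3.12; a binder is an assumption label; typed ≠ inhabited ≠ discharged. -/
theorem layer5_held_ex51v_v11_L27_genuine_fg (N : NFBridgeRecon.{0})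
    -- DATUM side-conditions of the genuine `K_rat = L̄_C` (as v0.5 conjunct 1)
    (hroot : ∀ a : N.Krat, a ≠ 0 → ∀ n : ℕ, 0 < n → ∃ b : N.Krat, b ^ n = a)
    (hprim : ∀ n : ℕ, 0 < n → ∃ ζ : N.Krat, IsPrimitiveRoot ζ n)
    -- STRUCTURAL (replaces LAW E51/L26): fixed fields of open normal subgroups finitely generated over the prime field
    (h_Ex51v_fg : ∀ H : OpenNormalSubgroup N.piRat, ∃ s : Finset N.Krat,
      ∀ a : N.Krat, (∀ h : N.piRat, h ∈ H → h • a = a) → a ∈ Subfield.closure (s : Set N.Krat))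
    -- DATA: orders at points; LAW (o) (as v0.5 conjunct 1)
    {X : Type v} (ord : X → N.Krat → ℤ)
    (h_Ex51v_ordmul : ∀ (x : X) (a b : N.Krat), a ≠ 0 → b ≠ 0 → (∀ g : N.piRat, g • a = a) → (∀ g : N.piRat, g • b = b) →
      ord x (a * b) = ord x a + ord x b)
    -- LAW Rmk 3.1.7 (i)/(ii) (as v0.2/v0.3/v0.5)
    (h_Ex51v_polex : ∀ f' ∈ N.Minfκx, (∀ g : N.piRat, g • f' = f') →
      ∀ x₁ x₂ : X, x₁ ≠ x₂ → ¬ (ord x₁ f' < 0 ∧ ord x₂ f' < 0))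
    (h_Ex51v_zero : ∃ f ∈ N.Minfκ, (∀ g : N.piRat, g • f = f) ∧
      ∃ x₁ x₂ : X, x₁ ≠ x₂ ∧ 0 < ord x₁ f ∧ 0 < ord x₂ f) :
    letI : MulDistribMulAction N.piRat N.Kratˣ := Units.mulDistribMulActionRight
    letI : RootableBy N.Kratˣ ℕ := rootableByOfPowLeftSurj N.Kratˣ ℕ fun hn => N.units_pow_surjective_of_roots hroot hn
    haveI : Nonempty (OpenNormalSubgroup N.piRat)ᵒᵈ :=
      ⟨OrderDual.toDual { toOpenSubgroup := ⊤, isNormal' := Subgroup.normal_of_characteristic ⊤ }⟩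
    UniqueCyclotomeIso                                                    -- E51/L27 at the genuine ∞κ container, symmetric form
      { μ₁ := cyclotome N.Kratˣ
        μ₂ := cyclotome N.Kratˣ
        H₁ := H1Colimit N.Kratˣ
          (fun i : (OpenNormalSubgroup N.piRat)ᵒᵈ => ((OrderDual.ofDual i : OpenNormalSubgroup N.piRat) : Subgroup N.piRat))
          N.openNormal_antitone
        H₂ := H1Colimit N.Kratˣ
          (fun i : (OpenNormalSubgroup N.piRat)ᵒᵈ => ((OrderDual.ofDual i : OpenNormalSubgroup N.piRat) : Subgroup N.piRat))
          N.openNormal_antitone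
        im₁ := Set.range fun f : N.infκPair.carrier =>
          kummerMap N.openNormal_antitone (N.isExhausted_openNormal fun _ _ => rfl)
            (Units.mk0 (f : N.Krat) (N.coe_infκPair_ne_zero f))
        im₂ := Set.range fun f : N.infκPair.carrier =>
          kummerMap N.openNormal_antitone (N.isExhausted_openNormal fun _ _ => rfl)
            (Units.mk0 (f : N.Krat) (N.coe_infκPair_ne_zero f))
        induced := fun e => H1ColimTwist
          (fun i : (OpenNormalSubgroup N.piRat)ᵒᵈ => ((OrderDual.ofDual i : OpenNormalSubgroup N.piRat) : Subgroup N.piRat))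
          N.openNormal_antitone
          ((Equiv.ofBijective _ (cyclotome.zhatTwist_bijective (R := N.Krat) hprim)).symm e) } := by
  haveI : CharZero N.Krat := N.charZero_krat_of_hprim hprim
  have hfg' : ∀ H : OpenNormalSubgroup N.piRat, ∃ s : Finset N.Krat, ∀ a : N.Krat,
      (∀ h : N.piRat, h ∈ H → h • a = a) → a ∈ IntermediateField.adjoin ℚ (s : Set N.Krat) := fun H => by
    obtain ⟨s, hs⟩ := h_Ex51v_fg H
    refine ⟨s, fun a ha => ?_⟩
    rw [← IntermediateField.mem_toSubfield, IntermediateField.adjoin_toSubfield]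
    exact Subfield.closure_mono Set.subset_union_right (hs a ha)
  exact N.uniqueCyclotomeIso_infκ_fieldLevel (fun hn => N.units_pow_surjective_of_roots hroot hn) hprim
    (N.hdiv_of_fixed_subset_adjoin_finset hfg') ord h_Ex51v_ordmul
    (fun f' hf' hfix => h_Ex51v_polex f' (N.minfκ_subset hf') hfix) h_Ex51v_zero

/-! ## E51/L27 «respectively ∞κ×» at the genuine container: (iv) discharged from finite generation -/

open scoped Classical in
/-- **Row 1116, node `IUTchI:Ex5.1(v)`, conjunct E51/L27 «respectively ∞κ×» at the genuine ∞κ× Kummer container (v0.8 coverage item) with (iv)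
DISCHARGED from finite generation** (abc-iut-f-190's `NFBridgeRecon.uniqueCyclotomeIso_infκx_fieldLevel` p443477 fed with
`hdiv := N.hdiv_of_fixed_subset_adjoin_finset …`).  `h_Ex51v_div` ↦ the structural `h_Ex51v_fg`; 0 new laws.  Nothing here asserts that abc is proved or
refuted or takes a side on [IUTchIII] Cor. 3.12; a binder is an assumption label; typed ≠ inhabited ≠ discharged. -/
theorem layer5_held_ex51v_v11_L27x_genuine_fg (N : NFBridgeRecon.{0})
    -- DATUM side-conditions of the genuine `K_rat = L̄_C` (as v0.5/v0.7)
    (hroot : ∀ a : N.Krat, a ≠ 0 → ∀ n : ℕ, 0 < n → ∃ b : N.Krat, b ^ n = a)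
    (hprim : ∀ n : ℕ, 0 < n → ∃ ζ : N.Krat, IsPrimitiveRoot ζ n)
    -- STRUCTURAL (replaces LAW E51/L26): fixed fields of open normal subgroups finitely generated over the prime field
    (h_Ex51v_fg : ∀ H : OpenNormalSubgroup N.piRat, ∃ s : Finset N.Krat,
      ∀ a : N.Krat, (∀ h : N.piRat, h ∈ H → h • a = a) → a ∈ Subfield.closure (s : Set N.Krat))
    -- DATA: orders at points; LAW (o) (as v0.5/v0.7)
    {X : Type v} (ord : X → N.Krat → ℤ)
    (h_Ex51v_ordmul : ∀ (x : X) (a b : N.Krat), a ≠ 0 → b ≠ 0 → (∀ g : N.piRat, g • a = a) → (∀ g : N.piRat, g • b = b) →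
      ord x (a * b) = ord x a + ord x b)
    -- LAW Rmk 3.1.7 (i)/(ii) (as v0.2/v0.3/v0.5/v0.7)
    (h_Ex51v_polex : ∀ f' ∈ N.Minfκx, (∀ g : N.piRat, g • f' = f') →
      ∀ x₁ x₂ : X, x₁ ≠ x₂ → ¬ (ord x₁ f' < 0 ∧ ord x₂ f' < 0))
    (h_Ex51v_zero : ∃ f ∈ N.Minfκ, (∀ g : N.piRat, g • f = f) ∧
      ∃ x₁ x₂ : X, x₁ ≠ x₂ ∧ 0 < ord x₁ f ∧ 0 < ord x₂ f) :
    letI : MulDistribMulAction N.piRat N.Kratˣ := Units.mulDistribMulActionRight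
    letI : RootableBy N.Kratˣ ℕ := rootableByOfPowLeftSurj N.Kratˣ ℕ fun hn => N.units_pow_surjective_of_roots hroot hn
    haveI : Nonempty (OpenNormalSubgroup N.piRat)ᵒᵈ :=
      ⟨OrderDual.toDual { toOpenSubgroup := ⊤, isNormal' := Subgroup.normal_of_characteristic ⊤ }⟩
    UniqueCyclotomeIso                                                    -- E51/L27 «resp. ∞κ×» at the genuine ∞κ× container
      { μ₁ := cyclotome N.Kratˣ
        μ₂ := cyclotome N.Kratˣ
        H₁ := H1Colimit N.Kratˣ
          (fun i : (OpenNormalSubgroup N.piRat)ᵒᵈ => ((OrderDual.ofDual i : OpenNormalSubgroup N.piRat) : Subgroup N.piRat))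
          N.openNormal_antitone
        H₂ := H1Colimit N.Kratˣ
          (fun i : (OpenNormalSubgroup N.piRat)ᵒᵈ => ((OrderDual.ofDual i : OpenNormalSubgroup N.piRat) : Subgroup N.piRat))
          N.openNormal_antitone
        im₁ := Set.range fun f : N.infκxPair.carrier =>
          kummerMap N.openNormal_antitone (N.isExhausted_openNormal fun _ _ => rfl)
            (Units.mk0 (f : N.Krat) (N.coe_ne_zero_of_subset N.Minfκx _ N.zero_notMem f))
        im₂ := Set.range fun f : N.infκxPair.carrier =>
          kummerMap N.openNormal_antitone (N.isExhausted_openNormal fun _ _ => rfl)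
            (Units.mk0 (f : N.Krat) (N.coe_ne_zero_of_subset N.Minfκx _ N.zero_notMem f))
        induced := fun e => H1ColimTwist
          (fun i : (OpenNormalSubgroup N.piRat)ᵒᵈ => ((OrderDual.ofDual i : OpenNormalSubgroup N.piRat) : Subgroup N.piRat))
          N.openNormal_antitone
          ((Equiv.ofBijective _ (cyclotome.zhatTwist_bijective (R := N.Krat) hprim)).symm e) } := by
  haveI : CharZero N.Krat := N.charZero_krat_of_hprim hprim
  have hfg' : ∀ H : OpenNormalSubgroup N.piRat, ∃ s : Finset N.Krat, ∀ a : N.Krat,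
      (∀ h : N.piRat, h ∈ H → h • a = a) → a ∈ IntermediateField.adjoin ℚ (s : Set N.Krat) := fun H => by
    obtain ⟨s, hs⟩ := h_Ex51v_fg H
    refine ⟨s, fun a ha => ?_⟩
    rw [← IntermediateField.mem_toSubfield, IntermediateField.adjoin_toSubfield]
    exact Subfield.closure_mono Set.subset_union_right (hs a ha)
  exact N.uniqueCyclotomeIso_infκx_fieldLevel (fun hn => N.units_pow_surjective_of_roots hroot hn) hprim
    (N.hdiv_of_fixed_subset_adjoin_finset hfg') ord h_Ex51v_ordmul h_Ex51v_polex
    (h_Ex51v_zero.imp fun _ hf => ⟨N.minfκ_subset hf.1, hf.2⟩)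

/-- **THE LAYER-5 CERTIFICATE v11 — SINGLE TOP OF RECORD**: the conjunction, BY NAME via `StatementOf`, of the v10 top `layer5_of_S_v10`
(`Conditional/Layer5OfSV10.lean`, p449860; through it v9 … v0 and the companion) and this module's four (iv)-discharged E51 conjuncts
`layer5_held_ex51v_v11_infκ_fg`, `…_infκx_fg`, `…_L27_genuine_fg`, `…_L27x_genuine_fg`.  CENSUS v11: headline most-reduced CONE 35 (+2 record-laws in
`P`, +1 in `M'`) · FACT 0 · side 16 · NV 3 (E51 field-level laws `ordmul polex zero` + structural `fg`).  S-FREE.  Nothing here asserts that abc is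
proved or refuted or takes a side on [IUTchIII] Cor. 3.12; a binder is an assumption label; typed ≠ discharged; indexed ≠ endorsed. -/
theorem layer5_of_S_v11 :
    Summit.ABC.IUTFork.DAG.PartL5a.StatementOf @layer5_of_S_v10 ∧
    Summit.ABC.IUTFork.DAG.PartL5a.StatementOf @layer5_held_ex51v_v11_infκ_fg ∧
    Summit.ABC.IUTFork.DAG.PartL5a.StatementOf @layer5_held_ex51v_v11_infκx_fg ∧
    Summit.ABC.IUTFork.DAG.PartL5a.StatementOf @layer5_held_ex51v_v11_L27_genuine_fg ∧
    Summit.ABC.IUTFork.DAG.PartL5a.StatementOf @layer5_held_ex51v_v11_L27x_genuine_fg :=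
  ⟨@layer5_of_S_v10, @layer5_held_ex51v_v11_infκ_fg, @layer5_held_ex51v_v11_infκx_fg, @layer5_held_ex51v_v11_L27_genuine_fg,
    @layer5_held_ex51v_v11_L27x_genuine_fg⟩

end Summit.ABC.IUTFork.Conditional

/-! ### Build-lane export guard (ops-buildfix bf1-g30, 2026-08-28; G11b-3 recipe v2 as in `GelbartRogawski1991/UnitaryDualPairSeesawCharacter`):
the theorems of this file carry very large dependent telescopes; at `.olean` export Lean 4.32's library-suggestion indexers fold over
every local theorem statement and do not finish within the build lane's one-hour clock (measured on a farm node: `lean -o` > 1 500 s, plain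
elaboration ≈ 20 s). ONE file-final `local` `[implicit_reducible]` keeps them out of that premise index (inert for Meta and the kernel on
theorems; no definition is tagged; statements and proofs unchanged). -/
set_option allowUnsafeReducibility true in
attribute [local implicit_reducible]
  _root_.Summit.ABC.IUTFork.Conditional.layer5_held_ex51v_v11_infκ_fg
  _root_.Summit.ABC.IUTFork.Conditional.layer5_held_ex51v_v11_infκx_fg
  _root_.Summit.ABC.IUTFork.Conditional.layer5_held_ex51v_v11_L27_genuine_fg
  _root_.Summit.ABC.IUTFork.Conditional.layer5_held_ex51v_v11_L27x_genuine_fg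
  _root_.Summit.ABC.IUTFork.Conditional.layer5_of_S_v11
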